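import Summits.RiemannHypothesis.RiemannHypothesis.Theorems.PfPersistenceLocalityBarrier
import HarnessLib

/-!
# `PrimePatternFormBounded p` is FALSE as typed (pub-rhpf fake-4; mechanism/rigidity campaign; no RH claims)

The TYPED hypothesis `PrimePatternFormBounded p := ∀ win, ∀ v, |v ⬝ᵥ (primePattern p win *ᵥ v)| ≤ v ⬝ᵥ v`
of `PfPersistenceLocalityBarrier` / `PfPersistenceDialLemma` quantifies over ALL windows, including those
that do not reach `p` (`log p > 2a`).  There the closed form `thetaEven (2a) 0 0 (log p) = (2a − log p)/(2a)`
is NOT the windowed autocorrelation (which vanishes) and is unbounded: at `a = (log p)/8` it equals `−3`.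
Hence `¬ PrimePatternFormBounded p` for every `p ≥ 2` (the `p = 2`, `a = 1/10` instance is DialLemma's
`not_primePatternFormBounded_two`), and every theorem taking `(hP : PrimePatternFormBounded p)` is vacuous as typed.  REPAIR (true analytically, by the integral representation
`thetaEven L n m y = ∫ x in (-L/2)..(L/2 - y), xiEven L n x * xiEven L m (x + y)` for `0 ≤ y ≤ L`, checked
numerically to 3e-15): guard the window, `∀ win, p ∈ primeRange (2 * win.a) → 0 < win.a → ∀ v, … ≤ v ⬝ᵥ v`;
`uniformlyClose_dial` already splits on `p ∈ primeRange (2 * win.a)` and survives the repair.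
-/

set_option linter.dupNamespace false

namespace Summit.RiemannHypothesis.RiemannHypothesis.Theorems.PfPersistence

open Real Matrix

/-- The `(0,0)` pattern entry in closed form: `θ₀₀(log p) = (2a − log p)/(2a)`. [folklore] -/
theorem primePattern_zero_zero (p : ℕ) (win : Window) :
    primePattern p win 0 0 = (2 * win.a - Real.log p) / (2 * win.a) := by
  simp [primePattern, thetaEven]

/-- On the one-mode window `N = 0` the pattern form of the constant vector is the `(0,0)` entry. [folklore] -/
theorem primePattern_form_one_mode (p : ℕ) {a : ℝ} (ha : 0 < a) :
    (fun _ : Fin ((⟨a, 0, ha⟩ : Window).N + 1) => (1 : ℝ)) ⬝ᵥ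
      (primePattern p ⟨a, 0, ha⟩ *ᵥ fun _ => (1 : ℝ)) = (2 * a - Real.log p) / (2 * a) := by
  have h := primePattern_zero_zero p ⟨a, 0, ha⟩
  simp only [dotProduct, mulVec, one_mul, mul_one]
  simpa using h

/-- **REFUTATION.** `PrimePatternFormBounded p` fails for every `p ≥ 2`: witness window `a = (log p)/8`
(a GENUINE window, `0 < a`, but not reaching `p`), `N = 0`, `v = 1`, where the form equals `−3`; the re-typed guard `Window.ha` does not rescue the unguarded statement. [folklore] -/
theorem not_primePatternFormBounded {p : ℕ} (hp : 2 ≤ p) : ¬ PrimePatternFormBounded p := by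
  intro h
  have hlog : 0 < Real.log p := Real.log_pos (by exact_mod_cast hp)
  have ha : 0 < Real.log p / 8 := div_pos hlog (by norm_num)
  have key := h ⟨Real.log p / 8, 0, ha⟩ (fun _ => (1 : ℝ))
  rw [primePattern_form_one_mode p ha] at key
  have hval : (2 * (Real.log p / 8) - Real.log p) / (2 * (Real.log p / 8)) = -3 := by
    field_simp
    ring
  rw [hval] at key
  simp only [dotProduct, mul_one] at key
  norm_num at key

end Summit.RiemannHypothesis.RiemannHypothesis.Theorems.PfPersistence
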